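import Summits.BirchSwinnertonDyer.BirchSwinnertonDyer.Theorems.GenusKolyvaginAtTwoK4NegPhantomCellDescentBitExact
import Summits.BirchSwinnertonDyer.Rank1Residual.X11b.BDPRouteRankOneBookkeeping
import HarnessLib

/-!
# Route `GenusKolyvaginAtTwo`, crux K₄⁻ `K4Neg` (stmt-BirchSwinnertonDyer-31526), the phantom cell F4ᵖᵍ — THE HEEGNER DESCENT BIT,
# part 7: the «`E(K)/2E(K)` cyclic» hypothesis of part 6 DISCHARGED from `rank E(K) = 1`, `E(K)[2] = 0`

Seat `bsd-line-gk2-p3` g34 (PROVER seat 3/3, cell `bsd-f1-sign2`), `--supports stmt-BirchSwinnertonDyer-31526 --as helper`.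
THEOREMS ONLY (no definition, no named fact, no `sorry`); standard axioms; UNCONDITIONAL.  **BSD is NOT proved by this file; K4Neg is NOT
proved; nothing is closed.**

* §1 `forall_exists_eq_zsmul_add_two_zsmul_of_mordellWeilRank_eq_one` — `rank E(K) = 1`, `E(K)[2] = 0`, `Q₀ ∉ 2E(K)` ⟹ every `R ∈ E(K)` is
  `m • Q₀ + 2 • R'` (Mordell–Weil: `E(K)/tors ≅ ℤ`, tree `X11b.RankOne.exists_coord_of_mordellWeilRank_eq_one`; odd torsion is `2`-divisible).
* §2 ★ `hHalf_iff_ne_capitulatingClass_of_mordellWeilRank_eq_one` — part 6's ★ with that hypothesis replaced by `(W.baseChange K).mordellWeilRank = 1`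
  and `Q₀ ∉ 2E(K)` (on the K₄⁻ cell: `Q₀ = y_K/2^{M₀}`, supplied with `s_y` by `KFourCell.existsUnique_resTorsion_eq_kummer_of_depth_pos_of_cell'`).

References: [SilvermanAEC2009] VIII.6.7; [Kramer1981] Thm. 1; [LawsonWuthrich2016] §7.1.
-/

set_option linter.dupNamespace false -- tree convention: `Summit.BirchSwinnertonDyer.BirchSwinnertonDyer.Theorems` (summit = sub-problem)
set_option autoImplicit false

noncomputable section

open scoped Classical NumberField Pointwise

namespace Summit.BirchSwinnertonDyer.BirchSwinnertonDyer.Theorems.GenusExact.PhantomDescentBit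

open WeierstrassCurve NumberField IsDedekindDomain Field
open Literature.NumberTheory.GaloisRepresentations Literature.NumberTheory.EllipticCurves
open Summit.BirchSwinnertonDyer.BirchSwinnertonDyer.Theorems.GenusExact.Lw2PhantomExclusion
open Summit.BirchSwinnertonDyer.BirchSwinnertonDyer.Theorems.GenusSupplyNarrow (two_smul_half_of_odd_addOrderOf)
open Summit.BirchSwinnertonDyer.BirchSwinnertonDyer.Theorems.GenusSupplyNarrow.DepthZero (odd_addOrderOf_of_two_torsionFree)

/-! ## §1 `E(K)/2E(K)` is generated by any non-`2`-divisible point when `rank E(K) = 1`, `E(K)[2] = 0` -/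

/-- **`rank = 1`, no `2`-torsion, `Q₀ ∉ 2E` ⟹ every point is `m • Q₀ + 2 • R'`.**  For an abelian group `A = E(K)` with a coordinate `c : A → ℤ`, `c Q = 1`,
`ker c` torsion (tree `X11b.RankOne.exists_coord_of_mordellWeilRank_eq_one`) and all torsion of ODD order (`A[2] = 0`): every `R` is `c(R) • Q + 2t`, and
`Q = Q₀ + 2S` when `c(Q₀)` is odd, which it is since `Q₀ ∉ 2A`.  [cite: SilvermanAEC2009, Thm. VIII.6.7] -/
theorem forall_exists_eq_zsmul_add_two_zsmul_of_mordellWeilRank_eq_one {K : Type} [Field K] [NumberField K]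
    (V : WeierstrassCurve K) [V.IsElliptic] (hrk : V.mordellWeilRank = 1)
    (h2 : ∀ P : V.toAffine.Point, (2 : ℤ) • P = 0 → P = 0)
    {Q₀ : V.toAffine.Point} (hQ₀ : ¬ ∃ R : V.toAffine.Point, (2 : ℤ) • R = Q₀) :
    ∀ R : V.toAffine.Point, ∃ (m : ℤ) (R' : V.toAffine.Point), R = m • Q₀ + (2 : ℤ) • R' := by
  obtain ⟨c, Q, hcQ, hker⟩ := Summit.BirchSwinnertonDyer.Rank1Residual.X11b.RankOne.exists_coord_of_mordellWeilRank_eq_one V hrk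
  -- every torsion point is `2`-divisible (odd order)
  have htor : ∀ t : V.toAffine.Point, IsOfFinAddOrder t → ∃ t' : V.toAffine.Point, (2 : ℤ) • t' = t := by
    intro t ht
    have hodd : Odd (addOrderOf t) :=
      odd_addOrderOf_of_two_torsionFree ht fun k hk ↦ h2 _ hk
    exact ⟨_, two_smul_half_of_odd_addOrderOf hodd⟩
  -- every point is `c(R) • Q + 2 t'`
  have hdec : ∀ R : V.toAffine.Point, ∃ t' : V.toAffine.Point, R = c R • Q + (2 : ℤ) • t' := by
    intro R
    have h0 : c (R - c R • Q) = 0 := by rw [map_sub, map_zsmul, hcQ, smul_eq_mul, mul_one, sub_self]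
    obtain ⟨t', ht'⟩ := htor _ (hker _ h0)
    exact ⟨t', by rw [ht']; abel⟩
  -- `c(Q₀)` is odd, so `Q = Q₀ + 2 S`
  obtain ⟨t₀, ht₀⟩ := hdec Q₀
  have hodd : Odd (c Q₀) := by
    rcases Int.even_or_odd (c Q₀) with ⟨j, hj⟩ | h
    · exfalso
      apply hQ₀
      refine ⟨j • Q + t₀, ?_⟩
      rw [ht₀, hj, smul_add, add_zsmul, two_zsmul]
    · exact h
  obtain ⟨j, hj⟩ := hodd
  have hQ : Q = Q₀ + (2 : ℤ) • (-(j • Q) - t₀) := by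
    have h := ht₀
    rw [hj, add_zsmul, one_zsmul, mul_zsmul] at h
    rw [smul_sub, smul_neg, h]
    abel
  intro R
  obtain ⟨t', ht'⟩ := hdec R
  refine ⟨c R, c R • (-(j • Q) - t₀) + t', ?_⟩
  have h : c R • Q₀ + (2 : ℤ) • (c R • (-(j • Q) - t₀) + t') =
      c R • (Q₀ + (2 : ℤ) • (-(j • Q) - t₀)) + (2 : ℤ) • t' := by
    rw [smul_add (c R), smul_add (2 : ℤ), smul_comm (c R) (2 : ℤ)]
    abel
  rw [h, ← hQ]
  exact ht'

/-! ## §2 `hHalf ⟺ ξ_E ≠ s_y` on the K₄⁻ cell, rank-one form -/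

/-- ★ **`hHalf ⟺ ξ_E ≠ s_y`, RANK-ONE FORM.**  As part 6's `hHalf_iff_ne_capitulatingClass`, with «`E(K)/2E(K) = ⟨Q₀⟩`» discharged from
`rank E(K) = 1` (on the K₄⁻ cell: `rank E(ℚ) = 0`, `rank E^{(d_K)}(ℚ) = 1`), `E(K)[2] = 0` (`ρ̄_{E,2}` onto, `K` imaginary quadratic) and `Q₀ ∉ 2E(K)`
(`Q₀ = y_K/2^{M₀}` at the exact depth).  BSD is NOT proved by this. [cite: LawsonWuthrich2016, §7.1] [cite: Kramer1981, Thm. 1] [cite: SilvermanAEC2009, VIII.6.7] -/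
theorem hHalf_iff_ne_capitulatingClass_of_mordellWeilRank_eq_one
    (W : WeierstrassCurve ℚ) [W.IsElliptic] {K : Type} [Field K] [NumberField K]
    (hρ : ∀ n : ℕ, 0 < n → W.HasSurjectiveModNGaloisRep ((2 : ℤ) ^ n)) (hK : IsImaginaryQuadratic K)
    (hodd : Odd (NumberField.discr K)) (hnsq₁ : ¬ IsSquare ((NumberField.discr K : ℚ) * -|W.Δ|))
    (hnsq₂ : ¬ IsSquare ((NumberField.discr K : ℚ) * (-(2 * |W.Δ|))))
    {ξ : galH1Torsion W (2 : ℤ)} (hξ0 : ξ ≠ 0) (hξ4 : ∀ h ∈ torsionFixing W (4 : ℤ), h1Eval W (2 : ℤ) ξ h = 0)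
    (hdiv : ∀ X : geomPoints (W.baseChange K), ∃ Y : geomPoints (W.baseChange K), (2 : ℤ) • Y = X)
    (hrk : (W.baseChange K).mordellWeilRank = 1)
    {Q₀ : (W.baseChange K).toAffine.Point} (hQ₀ : ¬ ∃ R : (W.baseChange K).toAffine.Point, (2 : ℤ) • R = Q₀)
    {s : galH1Torsion W (2 : ℤ)} (hs : resTorsion W K (2 : ℤ) s = kummerMapTorsion (W.baseChange K) (2 : ℤ) hdiv Q₀) :
    (∀ (R : (W.baseChange K).toAffine.Point) (Q : geomPoints (W.baseChange K)),
        (∀ ρ ∈ torsionFixing (W.baseChange K) (4 : ℤ), ρ • Q = Q) → (2 : ℤ) • Q = toGeomPoints (W.baseChange K) R →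
        ∃ R' : (W.baseChange K).toAffine.Point, (2 : ℤ) • R' = R) ↔ ξ ≠ s :=
  haveI : (W.baseChange K).IsElliptic := inferInstanceAs (W.map (algebraMap ℚ K)).IsElliptic
  hHalf_iff_ne_capitulatingClass W hρ hK hodd hnsq₁ hnsq₂ hξ0 hξ4 hdiv
    (forall_exists_eq_zsmul_add_two_zsmul_of_mordellWeilRank_eq_one (W.baseChange K) hrk
      (forall_two_zsmul_eq_zero_baseChange W hρ hK) hQ₀) hs

end Summit.BirchSwinnertonDyer.BirchSwinnertonDyer.Theorems.GenusExact.PhantomDescentBit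

end
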